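import Literature.MathematicalPhysics.QuantumFieldTheory.WilsonPlaquetteLargeFieldTail
import HarnessLib

/-!
# The single-plaquette EXPONENTIAL MOMENT and the PREFACTOR-FREE large-field tail of the Wilson lattice gauge theory,
# MODULO THE FREE-ENERGY SANDWICH (two displayed partition-function bounds) — `WilsonPlaquetteExpMomentSandwich`

statement-level skeleton of published techniques with citation tags; proofs where landed; nothing here is a claim about the
Yang–Mills mass gap

WHAT.  For the Wilson measure `μ_{Λ,β}` of a compact group `G` presented in `U(N)` by a continuous unitary representation `ρ` on the
torus `(ℤ/Lℤ)^d`, `L` even, `β ≥ 0`, `0 ≤ λ`, and the plaquette energy `φ(g) = N − Re tr ρ(g) ≥ 0`: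

* §1 `integral_plaquette_le_rpow_of_sandwich` — for every admissible plaquette observable `f ≥ 0` (bounded measurable class function,
  inversion-invariant) and reals `0 < zlow`, `0 ≤ zup` with  `zlow ≤ ∫ e^{−βS} dπ`  and  `∫ (∏_c f(U_{(c;0,a)}))·e^{−βS} dπ ≤ zup`
  (`π` = product Haar):  `∫ f(U_{(c₀;0,a)}) dμ_{Λ,β} ≤ (zup/zlow)^{1/L^d}` — the chessboard estimate of the tree
  (`PlaquetteChessboard.integral_plaquette_le_rpow_all`, [FrohlichIsraelLiebSimon1978] Thm. 4.1) followed by the ratio of the two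
  un-normalised integrals (`LatticeGaugeDLR.wilsonExpectation_eq_toReal_lintegral`);
* §2 the EXPONENTIAL WEIGHT `f_λ(g) = exp(λβφ(g))` is admissible, and on the array its product against the Boltzmann factor is dominated by
  the Boltzmann factor AT COUPLING `(1 − λ)β`:  `(∏_c f_λ(U_{(c;0,a)}))·e^{−βS(U)} ≤ e^{−(1−λ)βS(U)}`  (the other orientations' energies
  are `≥ 0`);
* §3 ★ `integral_exp_mul_plaquette_le_of_sandwich` — THE EXPONENTIAL MOMENT MODULO THE SANDWICH:
  `zlow ≤ Z_π(β)` and `Z_π((1−λ)β) ≤ zup` (`Z_π(β) := ∫ e^{−βS} dπ`) give `∫ exp(λβφ(U_{(c₀;0,a)})) dμ_{Λ,β} ≤ (zup/zlow)^{1/L^d}`;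
  ★ `measureReal_largePlaquette_le_of_sandwich` — by Chebyshev and `φ ≥ ‖ρ(g) − 1‖²/2` ((0.14) of [Balaban1987RG1]):
  `μ_{Λ,β}{θ ≤ ‖ρ(U_p) − 1‖} ≤ (zup/zlow)^{1/L^d} · e^{−λβθ²/2}` — NO volume-entropy prefactor beyond the per-site free-energy gap.

WHY (cell `ym3-torus`, rung R3 crux `HistoryTailL`, stmt-QuantumFields-19936; LEAD ★w1-19936 g6 2026-08-28 22:25Z (2) «prefactor-free
level-0 needs ⟨S⟩_β ≤ C·N/β without the convexity log»).  The tree's volume-uniform tail ✓`PlaquetteTail.measureReal_largePlaquette_le`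
([Gross1983] shape `cb^{−d}·e^{8Nβr²d²}·e^{−βθ²/2}`, i.e. `(1+β)^{d·dim G/2}·e^{−βθ²/2}`) bounds the NUMERATOR by `e^{−βL^dθ²/2}` (Haar mass
≤ 1) and the DENOMINATOR by the link ball on ALL edges; both sides of the exact Gaussian count `Z ≍ β^{−dim G·(#E−#V+1)/2}` are thereby
lost, and the `L^d`-th root of the loss is the polynomial prefactor.  The two displayed hypotheses of §3 are where the sharp count enters:
`zlow` = a TREE-GAUGE lower bound `e^{−C·L^d}(c_G β^{−dim G/2})^{#E−#V+1}` and `zup` = the TRIANGULAR (complete axial gauge) upper bound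
`(C_G((1−λ)β)^{−dim G/2})^{#E−#V+1−O(L^{d−1})}` — [Chatterjee2016] Thm 2.1 proves exactly this sandwich for `U(N)` on the box (free energy
`½(d−1−d/n+1/n^d)N² log g₀²` per site, O(1) error uniformly in `(n, g₀)`); with them `(zup/zlow)^{1/L^d} ≤ C·(1−λ)^{−(d−1)dim G/2}·β^{c/L}`.
Neither bound is proved HERE: this file is the assembly («door»); the sandwich is the located content (cell memo
`ym-ust-19936-w7/PREFACTOR-FREE-LEVEL0-w7g9.md`, typing rows T1/T2).  CAVEAT (LEAD ★w1-19936 g7, 2026-08-29 00:00Z): the residual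
`β^{c/L}` of the sandwich is NOT uniform in the coupling at FIXED small volume (`log β / L` is unbounded as `β → ∞` with `L` fixed); every
statement here keeps `zup`, `zlow` (hence `β`, `L`) DISPLAYED, and consumers absorb the residual themselves — nothing here is worded as a
coupling-uniform stub.

References: J. Fröhlich, R. Israel, E. H. Lieb, B. Simon, Commun. Math. Phys. 62 (1978) 1–34 [FrohlichIsraelLiebSimon1978] (Thm. 4.1);
L. Gross, Commun. Math. Phys. 92 (1983) 137–162 [Gross1983] (Thm. 3.6 (3.10)); S. Chatterjee, J. Funct. Anal. 271 (2016) 2944–3005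
[Chatterjee2016] (Thm 2.1, axial gauge); T. Bałaban, Commun. Math. Phys. 109 (1987) 249–301 [Balaban1987RG1] ((0.14) p.254).
Width seat `ym-ust-19936-w7` g9; `--supports stmt-QuantumFields-19936 --as helper`; THEOREMS ONLY (0 `def`, 0 `sorry`); count-neutral.
HONEST: nothing of the sandwich, of the crux, of rung R3 (YM₃ on T³ — not d = 4, not a mass gap, not Clay) is proved here.
-/

noncomputable section

open MeasureTheory Finset Filter Topology
open scoped Matrix.Norms.L2Operator ENNReal

namespace Literature.MathematicalPhysics.QuantumFieldTheory

namespace PlaquetteExpMoment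

open PlaquetteChessboard FariaDaVeigaOCarroll2022 PlaquetteTail
open Balaban1983to89.UnitaryModel Balaban1983to89.MatrixNorms

/-! ## §1 One plaquette against the array, against two partition-function bounds -/

section Sandwich

variable {d L m : ℕ} [NeZero d] [NeZero L]
variable {G : Type*} [Group G] [TopologicalSpace G] [IsTopologicalGroup G] [CompactSpace G]
  [MeasurableSpace G] [BorelSpace G] [SecondCountableTopology G]
variable (ρ : G →* Matrix (Fin m) (Fin m) ℂ)

/-- **One admissible plaquette observable against the sandwich.**  For `f ≥ 0` bounded measurable, a class function invariant under
inversion, and reals `0 < zlow ≤ ∫ e^{−βS} dπ`, `∫ (∏_c f(U_{(c;0,a)}))·e^{−βS} dπ ≤ zup` (`π` = product Haar):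
`∫ f(U_{(c₀;0,a)}) dμ_{Λ,β} ≤ (zup/zlow)^{1/L^d}` — chessboard ([FrohlichIsraelLiebSimon1978] Thm. 4.1, tree
`integral_plaquette_le_rpow_all`) and the ratio of un-normalised integrals. [cite: FrohlichIsraelLiebSimon1978, Thm. 4.1] -/
theorem integral_plaquette_le_rpow_of_sandwich [NeZero m] (hL : Even L) (hρc : Continuous ρ) {β : ℝ} (hβ : 0 ≤ β)
    {a : Fin d} (ha : a ≠ 0) {f : G → ℝ} (hf0 : ∀ g, 0 ≤ f g) (hfb : ∃ K : ℝ, ∀ g, |f g| ≤ K) (hfm : Measurable f)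
    (hconj : ∀ g h : G, f (h * g * h⁻¹) = f g) (hinv : ∀ g : G, f g⁻¹ = f g) {zlow zup : ℝ} (hzlow : 0 < zlow) (hzup : 0 ≤ zup)
    (hZ : ENNReal.ofReal zlow ≤
      ∫⁻ U, ENNReal.ofReal (Real.exp (-β * wilsonAction ρ U)) ∂(Measure.pi fun _ : Edge d L => haarProbability G))
    (hN : ∫⁻ U, ENNReal.ofReal (∏ c : Site d L, f (plaquetteHolonomy U c 0 a)) *
        ENNReal.ofReal (Real.exp (-β * wilsonAction ρ U)) ∂(Measure.pi fun _ : Edge d L => haarProbability G) ≤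
      ENNReal.ofReal zup)
    (c₀ : Site d L) :
    ∫ U, f (plaquetteHolonomy U c₀ 0 a) ∂(wilsonMeasure ρ β) ≤ (zup / zlow) ^ ((1 : ℝ) / (L : ℝ) ^ d) := by
  haveI := isProbabilityMeasure_wilsonMeasure (d := d) (L := L) ρ hρc β
  set π : Measure (GaugeConfig d L G) := Measure.pi fun _ : Edge d L => haarProbability G with hπ
  set F : GaugeConfig d L G → ℝ := fun U => ∏ c : Site d L, f (plaquetteHolonomy U c 0 a) with hF
  have hFm : Measurable F :=
    Finset.measurable_prod _ fun c _ => hfm.comp (measurable_plaquetteHolonomy c 0 a)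
  have hF0 : ∀ U, 0 ≤ F U := fun U => Finset.prod_nonneg fun c _ => hf0 _
  -- chessboard
  have hchess := integral_plaquette_le_rpow_all (L := L) ρ hL hρc hβ ha hf0 hfb hfm hconj hinv c₀
  refine hchess.trans ?_
  -- the array expectation as a ratio of un-normalised integrals
  have hexp : ∫ U, F U ∂(wilsonMeasure ρ β) = wilsonExpectation ρ β F := rfl
  have hratio : ∫ U, F U ∂(wilsonMeasure ρ β) ≤ zup / zlow := by
    rw [hexp, wilsonExpectation_eq_toReal_lintegral ρ hρc β hFm hF0]
    have hZ0 : (ENNReal.ofReal zlow) ≠ 0 := (ENNReal.ofReal_pos.mpr hzlow).ne'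
    calc ((∫⁻ U, ENNReal.ofReal (Real.exp (-β * wilsonAction ρ U)) ∂π)⁻¹ *
            ∫⁻ U, ENNReal.ofReal (F U) * ENNReal.ofReal (Real.exp (-β * wilsonAction ρ U)) ∂π).toReal
        ≤ ((ENNReal.ofReal zlow)⁻¹ * ENNReal.ofReal zup).toReal := by
          refine ENNReal.toReal_mono (ENNReal.mul_ne_top (ENNReal.inv_ne_top.mpr hZ0) ENNReal.ofReal_ne_top) ?_
          exact mul_le_mul' (ENNReal.inv_le_inv.mpr hZ) hN
      _ = zup / zlow := by
          rw [ENNReal.toReal_mul, ENNReal.toReal_inv, ENNReal.toReal_ofReal hzlow.le, ENNReal.toReal_ofReal hzup,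
            div_eq_mul_inv, mul_comm]
  have hI0 : 0 ≤ ∫ U, F U ∂(wilsonMeasure ρ β) := integral_nonneg fun U => hF0 U
  exact Real.rpow_le_rpow hI0 hratio (by positivity)

end Sandwich

/-! ## §2 The exponential plaquette weight `f_λ = exp(λβ(N − Re tr ρ))` -/

section ExpWeight

variable {m : ℕ} [NeZero m] {G : Type*} [Group G] (ρ : G →* Matrix (Fin m) (Fin m) ℂ)
  (hρu : ∀ g, ρ g ∈ Matrix.unitaryGroup (Fin m) ℂ)

/-- `Re Tr = N · (Re tr)` (normalised trace of the tree's `UnitaryModel`). [folklore] -/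
private theorem trace_re_eq_mul_nReTr' (W : Matrix (Fin m) (Fin m) ℂ) : (W.trace).re = (m : ℝ) * nReTr W := by
  have hm : (m : ℝ) ≠ 0 := Nat.cast_ne_zero.mpr (NeZero.ne m)
  rw [nReTr, Fintype.card_fin, mul_div_cancel₀ _ hm]

include hρu in
/-- `N − Re tr ρ(g) ≤ 2N` (unitary `ρ`). [cite: Balaban1987RG1, (0.2) p.252] -/
theorem actionTerm_le_two_mul (g : G) : (m : ℝ) - (ρ g).trace.re ≤ 2 * m := by
  rw [trace_re_eq_mul_nReTr']
  have h := (abs_le.mp (abs_nReTr_le_one (hρu g))).1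
  have hm : (0 : ℝ) ≤ m := Nat.cast_nonneg m
  nlinarith

omit [NeZero m] in
/-- `f_λ ≥ 0`. [folklore] -/
private theorem expWeight_nonneg (c : ℝ) (g : G) : 0 ≤ Real.exp (c * ((m : ℝ) - (ρ g).trace.re)) := (Real.exp_pos _).le

include hρu in
/-- `f_λ ≤ e^{2Nc}` for `c ≥ 0` (bounded on the compact group). [folklore] -/
private theorem abs_expWeight_le {c : ℝ} (hc : 0 ≤ c) (g : G) :
    |Real.exp (c * ((m : ℝ) - (ρ g).trace.re))| ≤ Real.exp (c * (2 * m)) := by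
  rw [abs_of_nonneg (Real.exp_pos _).le]
  exact Real.exp_le_exp.mpr (mul_le_mul_of_nonneg_left (actionTerm_le_two_mul ρ hρu g) hc)

omit [NeZero m] in
/-- `f_λ` is measurable for a continuous representation. [folklore] -/
private theorem measurable_expWeight [TopologicalSpace G] [MeasurableSpace G] [BorelSpace G] (hρc : Continuous ρ) (c : ℝ) :
    Measurable fun g : G => Real.exp (c * ((m : ℝ) - (ρ g).trace.re)) := by
  refine (Real.continuous_exp.comp (continuous_const.mul (continuous_const.sub ?_))).measurable
  exact Complex.continuous_re.comp (continuous_id.matrix_trace.comp hρc)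

/-- `f_λ` is a class function (trace is cyclic). [cite: Balaban1985Averaging, (12) p.19] -/
theorem expWeight_conj (c : ℝ) (g h : G) :
    Real.exp (c * ((m : ℝ) - (ρ (h * g * h⁻¹)).trace.re)) = Real.exp (c * ((m : ℝ) - (ρ g).trace.re)) := by
  rw [trace_re_eq_mul_nReTr', trace_re_eq_mul_nReTr', nReTr_map_conj ρ g h]

include hρu in
/-- `f_λ` is invariant under inversion (`Re tr ρ(g⁻¹) = Re tr ρ(g)*`). [folklore] -/
private theorem expWeight_inv (c : ℝ) (g : G) :
    Real.exp (c * ((m : ℝ) - (ρ g⁻¹).trace.re)) = Real.exp (c * ((m : ℝ) - (ρ g).trace.re)) := by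
  rw [trace_re_eq_mul_nReTr', trace_re_eq_mul_nReTr', nReTr_map_inv ρ hρu g]

end ExpWeight

section Domination

variable {d L m : ℕ} [NeZero d] [NeZero L] [NeZero m] {G : Type*} [Group G] (ρ : G →* Matrix (Fin m) (Fin m) ℂ)
  (hρu : ∀ g, ρ g ∈ Matrix.unitaryGroup (Fin m) ℂ)

include hρu in
/-- **The array's exponential weight against the Boltzmann factor is the Boltzmann factor at coupling `(1−λ)β`**, up to the
(non-negative) energies of the other orientations: pointwise, for `0 ≤ λ`, `β ≥ 0`,
`(∏_c e^{λβφ(U_{(c;0,a)})}) · e^{−βS(U)} ≤ e^{−(1−λ)βS(U)}`. [cite: Gross1983, Thm. 3.6 (3.10) p.146 (mechanism)] -/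
theorem prod_expWeight_mul_boltzmann_le {a : Fin d} (ha : (0 : Fin d) < a) {lam β : ℝ} (hlam : 0 ≤ lam)
    (hβ : 0 ≤ β) (U : GaugeConfig d L G) :
    (∏ c : Site d L, Real.exp (lam * β * ((m : ℝ) - (ρ (plaquetteHolonomy U c 0 a)).trace.re))) *
        Real.exp (-β * wilsonAction ρ U) ≤
      Real.exp (-((1 - lam) * β) * wilsonAction ρ U) := by
  classical
  rw [← Real.exp_sum, ← Real.exp_add]
  refine Real.exp_le_exp.mpr ?_
  -- the array's energy is at most the whole action
  have harr : ∑ c : Site d L, ((m : ℝ) - (ρ (plaquetteHolonomy U c 0 a)).trace.re) ≤ wilsonAction ρ U := by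
    unfold wilsonAction
    set ι : Site d L → Plaquette d L := fun c => (c, ⟨((0 : Fin d), a), ha⟩) with hι
    have hinj : Function.Injective ι := fun c c' h => by
      have := congrArg Prod.fst h; exact this
    calc ∑ c : Site d L, ((m : ℝ) - (ρ (plaquetteHolonomy U c 0 a)).trace.re)
        = ∑ c : Site d L, ((m : ℝ) - (ρ (plaquetteHolonomy U (ι c).1 (ι c).2.1.1 (ι c).2.1.2)).trace.re) := rfl
      _ = ∑ p ∈ (Finset.univ : Finset (Site d L)).image ι,
            ((m : ℝ) - (ρ (plaquetteHolonomy U p.1 p.2.1.1 p.2.1.2)).trace.re) := by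
          rw [Finset.sum_image fun c _ c' _ h => hinj h]
      _ ≤ ∑ p : Plaquette d L, ((m : ℝ) - (ρ (plaquetteHolonomy U p.1 p.2.1.1 p.2.1.2)).trace.re) :=
          Finset.sum_le_sum_of_subset_of_nonneg (Finset.subset_univ _) fun p _ _ => actionTerm_nonneg ρ hρu _
  have hsum : ∑ c : Site d L, lam * β * ((m : ℝ) - (ρ (plaquetteHolonomy U c 0 a)).trace.re) =
      lam * β * ∑ c : Site d L, ((m : ℝ) - (ρ (plaquetteHolonomy U c 0 a)).trace.re) := by
    rw [Finset.mul_sum]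
  rw [hsum]
  have hlb : 0 ≤ lam * β := mul_nonneg hlam hβ
  have e := mul_le_mul_of_nonneg_left harr hlb
  nlinarith [e]

end Domination

/-! ## §3 ★ The exponential moment and the prefactor-free tail, modulo the sandwich -/

section Main

variable {d L m : ℕ} [NeZero d] [NeZero L] [NeZero m]
variable {G : Type*} [Group G] [TopologicalSpace G] [IsTopologicalGroup G] [CompactSpace G]
  [MeasurableSpace G] [BorelSpace G] [SecondCountableTopology G]
variable (ρ : G →* Matrix (Fin m) (Fin m) ℂ) (hρu : ∀ g, ρ g ∈ Matrix.unitaryGroup (Fin m) ℂ)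

include hρu in
/-- ★ **THE SINGLE-PLAQUETTE EXPONENTIAL MOMENT MODULO THE FREE-ENERGY SANDWICH.**  `L` even, `β ≥ 0`, `0 ≤ λ` (`< 1` in use), `0 < a`; if
`0 < zlow ≤ Z_π(β) := ∫ e^{−βS} dπ` and `Z_π((1−λ)β) ≤ zup` then
`∫ exp(λβ(N − Re tr ρ(U_{(c₀;0,a)}))) dμ_{Λ,β} ≤ (zup/zlow)^{1/L^d}`.
With the tree-gauge lower bound and the axial-gauge upper bound of [Chatterjee2016] Thm 2.1's proof as `zlow`, `zup` the right-hand side is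
`C·(1−λ)^{−(d−1)·dim G/2}·β^{c/L}` — no volume-entropy power of `β`. [cite: FrohlichIsraelLiebSimon1978, Thm. 4.1; Chatterjee2016, Thm 2.1] -/
theorem integral_exp_mul_plaquette_le_of_sandwich (hL : Even L) (hρc : Continuous ρ) {β : ℝ} (hβ : 0 ≤ β)
    {a : Fin d} (ha : (0 : Fin d) < a) {lam : ℝ} (hlam : 0 ≤ lam) {zlow zup : ℝ} (hzlow : 0 < zlow)
    (hzup : 0 ≤ zup)
    (hZ : ENNReal.ofReal zlow ≤
      ∫⁻ U, ENNReal.ofReal (Real.exp (-β * wilsonAction ρ U)) ∂(Measure.pi fun _ : Edge d L => haarProbability G))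
    (hZup : ∫⁻ U, ENNReal.ofReal (Real.exp (-((1 - lam) * β) * wilsonAction ρ U))
        ∂(Measure.pi fun _ : Edge d L => haarProbability G) ≤ ENNReal.ofReal zup)
    (c₀ : Site d L) :
    ∫ U, Real.exp (lam * β * ((m : ℝ) - (ρ (plaquetteHolonomy U c₀ 0 a)).trace.re)) ∂(wilsonMeasure ρ β) ≤
      (zup / zlow) ^ ((1 : ℝ) / (L : ℝ) ^ d) := by
  have ha' : a ≠ 0 := ne_of_gt ha
  refine integral_plaquette_le_rpow_of_sandwich (L := L) ρ hL hρc hβ ha' (f := fun g => Real.exp (lam * β * ((m : ℝ) - (ρ g).trace.re)))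
    (expWeight_nonneg ρ (lam * β)) ⟨_, abs_expWeight_le ρ hρu (mul_nonneg hlam hβ)⟩ (measurable_expWeight ρ hρc (lam * β))
    (expWeight_conj ρ (lam * β)) (expWeight_inv ρ hρu (lam * β)) hzlow hzup hZ ?_ c₀
  -- the numerator: dominated by the Boltzmann integral at coupling `(1−λ)β`
  refine le_trans (lintegral_mono fun U => ?_) hZup
  rw [← ENNReal.ofReal_mul (Finset.prod_nonneg fun c _ => expWeight_nonneg ρ (lam * β) _)]
  exact ENNReal.ofReal_le_ofReal (prod_expWeight_mul_boltzmann_le ρ hρu ha hlam hβ U)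

include hρu in
/-- ★ **THE PREFACTOR-FREE SINGLE-PLAQUETTE TAIL MODULO THE SANDWICH**: under the hypotheses of
`integral_exp_mul_plaquette_le_of_sandwich`, for every `θ ≥ 0`,
`μ_{Λ,β}{θ ≤ ‖ρ(U_{(c₀;0,a)}) − 1‖} ≤ (zup/zlow)^{1/L^d} · e^{−λβθ²/2}` (Chebyshev with `f_λ ≥ e^{λβθ²/2}` on the event, by
`N − Re tr ρ(g) ≥ ‖ρ(g) − 1‖²/2`, [Balaban1987RG1] (0.14)). [cite: Gross1983, Thm. 3.6 (3.10) p.146; Balaban1987RG1, (0.14) p.254] -/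
theorem measureReal_largePlaquette_le_of_sandwich (hL : Even L) (hρc : Continuous ρ) {β : ℝ} (hβ : 0 ≤ β)
    {a : Fin d} (ha : (0 : Fin d) < a) {lam : ℝ} (hlam : 0 ≤ lam) {zlow zup : ℝ} (hzlow : 0 < zlow)
    (hzup : 0 ≤ zup)
    (hZ : ENNReal.ofReal zlow ≤
      ∫⁻ U, ENNReal.ofReal (Real.exp (-β * wilsonAction ρ U)) ∂(Measure.pi fun _ : Edge d L => haarProbability G))
    (hZup : ∫⁻ U, ENNReal.ofReal (Real.exp (-((1 - lam) * β) * wilsonAction ρ U))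
        ∂(Measure.pi fun _ : Edge d L => haarProbability G) ≤ ENNReal.ofReal zup)
    (c₀ : Site d L) {θ : ℝ} (hθ : 0 ≤ θ) :
    (wilsonMeasure ρ β).real {U : GaugeConfig d L G | θ ≤ ‖ρ (plaquetteHolonomy U c₀ 0 a) - 1‖} ≤
      (zup / zlow) ^ ((1 : ℝ) / (L : ℝ) ^ d) * Real.exp (-(lam * β * θ ^ 2 / 2)) := by
  haveI := isProbabilityMeasure_wilsonMeasure (d := d) (L := L) ρ hρc β
  set μ := wilsonMeasure (d := d) (L := L) ρ β with hμ
  set f : GaugeConfig d L G → ℝ := fun U => Real.exp (lam * β * ((m : ℝ) - (ρ (plaquetteHolonomy U c₀ 0 a)).trace.re)) with hf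
  set E : Set (GaugeConfig d L G) := {U | θ ≤ ‖ρ (plaquetteHolonomy U c₀ 0 a) - 1‖} with hE
  have hEm : MeasurableSet E :=
    measurableSet_le measurable_const (((hρc.sub continuous_const).norm).measurable.comp (measurable_plaquetteHolonomy c₀ 0 a))
  have hfm : Measurable f := (measurable_expWeight ρ hρc (lam * β)).comp (measurable_plaquetteHolonomy c₀ 0 a)
  have hf0 : ∀ U, 0 ≤ f U := fun U => expWeight_nonneg ρ (lam * β) _
  have hfint : Integrable f μ := by
    refine Integrable.of_bound hfm.aestronglyMeasurable (Real.exp (lam * β * (2 * m))) (ae_of_all _ fun U => ?_)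
    rw [Real.norm_eq_abs]
    exact abs_expWeight_le ρ hρu (mul_nonneg hlam hβ) _
  -- on the event, `f ≥ e^{λβθ²/2}`
  set t : ℝ := Real.exp (lam * β * θ ^ 2 / 2) with ht
  have ht0 : 0 < t := Real.exp_pos _
  have hfE : ∀ U ∈ E, t ≤ f U := fun U hU => by
    refine Real.exp_le_exp.mpr ?_
    have h := half_sq_le_actionTerm ρ hρu hθ hU
    have hlb : 0 ≤ lam * β := mul_nonneg hlam hβ
    have := mul_le_mul_of_nonneg_left h hlb
    linarith
  -- Chebyshev: `t · μ(E) ≤ ∫ f`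
  have hcheb : t * μ.real E ≤ ∫ U, f U ∂μ := by
    have h1 : t * μ.real E = ∫ U in E, t ∂μ := by
      rw [setIntegral_const, smul_eq_mul, mul_comm]
    rw [h1]
    calc ∫ U in E, t ∂μ ≤ ∫ U in E, f U ∂μ :=
          setIntegral_mono_on (integrable_const t).integrableOn hfint.integrableOn hEm fun U hU => hfE U hU
      _ ≤ ∫ U, f U ∂μ := setIntegral_le_integral hfint (ae_of_all _ hf0)
  have hmom := integral_exp_mul_plaquette_le_of_sandwich (L := L) ρ hρu hL hρc hβ ha hlam hzlow hzup hZ hZup c₀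
  have hquot : μ.real E ≤ (∫ U, f U ∂μ) / t := by
    rw [le_div_iff₀ ht0, mul_comm]; exact hcheb
  calc μ.real E ≤ (∫ U, f U ∂μ) / t := hquot
    _ ≤ (zup / zlow) ^ ((1 : ℝ) / (L : ℝ) ^ d) / t := div_le_div_of_nonneg_right hmom ht0.le
    _ = (zup / zlow) ^ ((1 : ℝ) / (L : ℝ) ^ d) * Real.exp (-(lam * β * θ ^ 2 / 2)) := by
        rw [ht, Real.exp_neg, div_eq_mul_inv]

end Main

end PlaquetteExpMoment

end Literature.MathematicalPhysics.QuantumFieldTheory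

end
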